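import Summits.KontsevichZagierPeriods.KontsevichZagierPeriods.Theses.SymplecticScissors
import Literature.NumberTheory.Transcendental.AyoubPeriodSeries
import Literature.NumberTheory.Transcendental.AyoubPeriodSeriesKernel
import Literature.NumberTheory.Transcendental.AyoubPeriodSeriesPiAlgebraic
import Literature.NumberTheory.Transcendental.AyoubPeriodSeriesLocalizing
import Literature.NumberTheory.Transcendental.AyoubPeriodSeriesTorsion
import Summits.KontsevichZagierPeriods.KontsevichZagierPeriods.Theorems.SymplecticScissorsTypeAGenerationRatOneVarLayer
import Summits.KontsevichZagierPeriods.KontsevichZagierPeriods.Theorems.SymplecticScissorsTypeAGenerationStubCovSubstAnalytic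
import Summits.KontsevichZagierPeriods.KontsevichZagierPeriods.Theorems.SymplecticScissorsTypeAGenerationStubCovSubstAnalyticAux
import Summits.KontsevichZagierPeriods.KontsevichZagierPeriods.Theorems.SymplecticScissorsTypeAGenerationStubCovPolyAux

/-!
# `TypeAGeneration` (stmt-KontsevichZagierPeriods-18392), line `Sketch`, stub
`stub_sqrtInstance_of` (F6): the first irrational algebraic instance of Ayoub's Conjecture 1.1
certified inside type (a)

Registered stub `stub_sqrtInstance_of` of the crux `TypeAGeneration` (route SymplecticScissors,
line `Sketch` = card stokes-compiler), on top of
`Literature/NumberTheory/Transcendental/AyoubPeriodSeries.lean` (`AyoubRel.CSeries = ℂ[[z₀, z₁, …]]`,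
`AyoubRel.Oan σ = 𝒪_{k-alg}(𝔻̄^∞)`, `AyoubRel.relAC`, `AyoubRel.intC = ∫_{[0,1]^∞}`), the landed rungs
G1–G3 (binomial germs `(1 − zᵢ/α)^q`: membership, formal calculus, the face `zᵢ = 1`), V0 (the
substitution `zᵢ ↦ u(zᵢ)` of a one-variable series) and the polynomial package `c3_*`.

**The instance.** `F₀ = √(4 − z₀) − (16/3 − 2√3) = 2·(1 − z₀/4)^{1/2} − κ` with
`κ = ∫₀¹ √(4 − z) dz = (2/3)(8 − 3√3)` (an *algebraic* number, so `F₀ ∈ 𝒪_{ℚ-alg}(𝔻̄^∞)` and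
`∫ F₀ = 0`). GIVEN the lead's Layer 1.5 (`stub_genusZeroWithRoomLayer`: genus-0 one-variable
integrands with room and a polynomial parametrisation are type (a)), `F₀` is type (a): with
`e = 1 − √3/2` and `u(t) = 8e t − 4e² t²` one has `u(0) = 0`, `u(1) = 4e(2 − e) = 4 − 3 = 1` and
`1 − u(t)/4 = (1 − e t)²`, so `F₀(u(z₀)) = 2(1 − e z₀) − κ` is a POLYNOMIAL (the square root is
extracted formally: `S = (1 − u(z₀)/4)^{1/2}` satisfies `S² = (1 − e z₀)²` and `S(0) = 1`, hence
`S = 1 − e z₀` in the domain `ℂ[[z]]`), the pulled-back integrand `F₀(u)u′` is rational with algebraic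
coefficients, and the room `2 + 8e + 4e² ≈ 3.14 < 7/2 < 4 =` polyradius of `F₀` holds. The value
`∫₀¹ (1 − z/4)^{1/2} dz = 8/3 − √3` is read off the primitive `−(8/3)(1 − z₀/4)^{3/2}`:
`∫ ∂₀G = G|_{z₀=1} − G|_{z₀=0}` (type (a) integrates to zero) and `(3/4)^{3/2} = 3√3/8`.

Elementary (folklore) given the cited conjecture's Layer 1.5; no definition is introduced
(`binGerm[i, α, a]`, `uFam[i, u]` and the constants are local notations).
-/

noncomputable section

-- `Summit.KontsevichZagierPeriods.KontsevichZagierPeriods.…` is the tree's mandated layout (single-conjunct summit).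
set_option linter.dupNamespace false

namespace Summit.KontsevichZagierPeriods.KontsevichZagierPeriods.TypeAGenerationLine

open Finsupp MvPowerSeries
open Literature.NumberTheory.Transcendental
open Literature.NumberTheory.Transcendental.AyoubRel

/-- The binomial germ `(1 − zᵢ/α)^a ∈ ℂ[[z]]`. -/
local notation3 "binGerm[" i ", " α ", " a "]" =>
  (MvPowerSeries.rename (⇑(axisEmb i))
    (PowerSeries.rescale (-(α : ℂ)⁻¹) (PowerSeries.binomialSeries ℂ (a : ℂ)) : MvPowerSeries Unit ℂ) :
    CSeries)

/-- The substitution family `zᵢ ↦ u(zᵢ)`, `z_l ↦ z_l` (`l ≠ i`). -/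
local notation3 "uFam[" i ", " u "]" =>
  (fun l : ℕ => if l = i then Polynomial.aeval (X i : CSeries) u else (X l : CSeries))

/-- `√3` as a complex number. -/
local notation3 "rt3" => (((Real.sqrt 3 : ℝ) : ℂ))

/-- `e = 1 − √3/2` (so that `4 − u(t) = 4(1 − e t)²`). -/
local notation3 "eF6" => ((1 : ℂ) - rt3 / 2)

/-- `κ = ∫₀¹ √(4 − z) dz = 16/3 − 2√3`. -/
local notation3 "κF6" => ((16 / 3 : ℂ) - 2 * rt3)

/-- The parametrisation `u(t) = 8e t − 4e² t²`. -/
local notation3 "uF6" =>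
  (Polynomial.monomial 1 (8 * eF6) + Polynomial.monomial 2 (-(4 * eF6 ^ 2)) : Polynomial ℂ)

/-- The germ `b = (1 − z₀/4)^{1/2}`. -/
local notation3 "bF6" => binGerm[0, (4 : ℂ), ((1 / 2 : ℚ) : ℂ)]

/-- The instance `F₀ = 2·(1 − z₀/4)^{1/2} − κ = √(4 − z₀) − (16/3 − 2√3)`. -/
local notation3 "F0F6" => ((2 : ℂ) • bF6 - C κF6)

/-- The polynomial `2(1 − e t) − κ = F₀(u(t))`. -/
local notation3 "pF6" =>
  (Polynomial.monomial 0 ((2 : ℂ) - κF6) + Polynomial.monomial 1 (-(2 * eF6)) : Polynomial ℂ)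

/-! ## The constants `√3`, `e = 1 − √3/2`, `κ = 16/3 − 2√3` -/

/-- `√3 · √3 = 3` in `ℂ`. [folklore] -/
theorem f6_rt3_mul_self : rt3 * rt3 = 3 := by
  rw [← Complex.ofReal_mul, Real.mul_self_sqrt (by norm_num : (0:ℝ) ≤ 3)]
  norm_num

/-- Natural numerals are algebraic over `ℚ`. [folklore] -/
theorem f6_isAlgebraic_ofNat (n : ℕ) [n.AtLeastTwo] : IsAlgebraic ℚ ((OfNat.ofNat n : ℂ)) := by
  exact_mod_cast isAlgebraic_nat (R := ℚ) (A := ℂ) n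

/-- `√3` is algebraic over `ℚ` (its square is `3`). [folklore] -/
theorem f6_isAlgebraic_rt3 : IsAlgebraic ℚ rt3 := by
  refine IsAlgebraic.of_pow two_pos ?_
  rw [sq, f6_rt3_mul_self]
  exact f6_isAlgebraic_ofNat 3

/-- `e = 1 − √3/2` is algebraic over `ℚ`. [folklore] -/
theorem f6_isAlgebraic_e : IsAlgebraic ℚ eF6 :=
  isAlgebraic_one.sub (f6_isAlgebraic_rt3.mul (f6_isAlgebraic_ofNat 2).inv)

/-- `κ = 16/3 − 2√3` is algebraic over `ℚ`. [folklore] -/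
theorem f6_isAlgebraic_kappa : IsAlgebraic ℚ κF6 :=
  ((f6_isAlgebraic_ofNat 16).mul (f6_isAlgebraic_ofNat 3).inv).sub
    ((f6_isAlgebraic_ofNat 2).mul f6_isAlgebraic_rt3)

/-! ## The parametrisation `u(t) = 8e t − 4e² t²` -/

/-- Coefficients of `u`. [folklore] -/
theorem f6_coeff_u (n : ℕ) :
    Polynomial.coeff uF6 n = (if 1 = n then 8 * eF6 else 0) + (if 2 = n then -(4 * eF6 ^ 2) else 0) := by
  rw [Polynomial.coeff_add, Polynomial.coeff_monomial, Polynomial.coeff_monomial]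

/-- The coefficients of `u` are algebraic. [folklore] -/
theorem f6_u_alg (n : ℕ) : IsAlgebraic ℚ (Polynomial.coeff uF6 n) := by
  rw [f6_coeff_u]
  refine IsAlgebraic.add ?_ ?_
  · split_ifs
    · exact (f6_isAlgebraic_ofNat 8).mul f6_isAlgebraic_e
    · exact isAlgebraic_zero
  · split_ifs
    · exact ((f6_isAlgebraic_ofNat 4).mul (f6_isAlgebraic_e.pow 2)).neg
    · exact isAlgebraic_zero

/-- The coefficients of `u′` are algebraic. [folklore] -/
theorem f6_du_alg (n : ℕ) : IsAlgebraic ℚ (Polynomial.coeff (Polynomial.derivative uF6) n) := by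
  rw [Polynomial.coeff_derivative]
  exact (f6_u_alg (n + 1)).mul ((isAlgebraic_nat n).add isAlgebraic_one)

/-- `u(0) = 0`. [folklore] -/
theorem f6_u_eval_zero : Polynomial.eval 0 uF6 = 0 := by
  simp [Polynomial.eval_add, Polynomial.eval_monomial]

/-- `u(1) = 8e − 4e² = 4 − 3 = 1`. [folklore] -/
theorem f6_u_eval_one : Polynomial.eval 1 uF6 = 1 := by
  simp only [Polynomial.eval_add, Polynomial.eval_monomial, one_pow, mul_one]
  linear_combination (-1 : ℂ) * f6_rt3_mul_self

/-- **Room**: `2 + Σ_k |u_k| = 2 + 8e + 4e² < 7/2` (`e = 1 − √3/2 < 0.15`). [folklore] -/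
theorem f6_room : 2 + (∑ n ∈ (uF6).support, ‖Polynomial.coeff uF6 n‖) < 7 / 2 := by
  have hsub : (uF6).support ⊆ ({1, 2} : Finset ℕ) := by
    intro n hn
    rw [Polynomial.mem_support_iff, f6_coeff_u] at hn
    rw [Finset.mem_insert, Finset.mem_singleton]
    by_contra h
    push Not at h
    apply hn
    rw [if_neg (Ne.symm h.1), if_neg (Ne.symm h.2), add_zero]
  have hle : (∑ n ∈ (uF6).support, ‖Polynomial.coeff uF6 n‖) ≤
      ∑ n ∈ ({1, 2} : Finset ℕ), ‖Polynomial.coeff uF6 n‖ :=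
    Finset.sum_le_sum_of_subset_of_nonneg hsub fun _ _ _ => norm_nonneg _
  rw [Finset.sum_pair (by norm_num : (1:ℕ) ≠ 2), f6_coeff_u, f6_coeff_u] at hle
  simp only [if_true, show (1:ℕ) ≠ 2 from by norm_num, show (2:ℕ) ≠ 1 from by norm_num, if_false,
    add_zero, zero_add, norm_neg] at hle
  have hlt : Real.sqrt 3 < 2 := by
    rw [Real.sqrt_lt' (by norm_num)]
    norm_num
  have hgt : (17 / 10 : ℝ) < Real.sqrt 3 := by
    rw [Real.lt_sqrt (by norm_num)]
    norm_num
  have hA : ‖(8 : ℂ) * eF6‖ = 8 * (1 - Real.sqrt 3 / 2) := by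
    rw [show (8 : ℂ) * eF6 = ((8 * (1 - Real.sqrt 3 / 2) : ℝ) : ℂ) by push_cast; ring,
      Complex.norm_of_nonneg (by nlinarith)]
  have hB : ‖(4 : ℂ) * eF6 ^ 2‖ = 4 * (1 - Real.sqrt 3 / 2) ^ 2 := by
    rw [show (4 : ℂ) * eF6 ^ 2 = ((4 * (1 - Real.sqrt 3 / 2) ^ 2 : ℝ) : ℂ) by push_cast; ring,
      Complex.norm_of_nonneg (by positivity)]
  rw [hA, hB] at hle
  nlinarith [Real.mul_self_sqrt (show (0 : ℝ) ≤ 3 by norm_num)]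

/-! ## The germ `b = (1 − z₀/4)^{1/2}` and the instance `F₀ = 2b − κ` -/

/-- `‖4‖ > 1`. [folklore] -/
theorem f6_four_norm : 1 < ‖(4 : ℂ)‖ := by norm_num

/-- G1 for `b = (1 − z₀/4)^{1/2}`. [folklore] -/
theorem f6_bG1 :
    bF6 ∈ Oan (algebraMap ℚ ℂ) ∧ (∀ l : ℕ, UsesVar bF6 l → l = 0) ∧
      (∀ ρ : ℕ → ℝ, (∀ l, 0 ≤ ρ l) → ρ 0 < ‖(4 : ℂ)‖ →
        Summable fun a : ℕ →₀ ℕ => ‖MvPowerSeries.coeff a bF6‖ * a.prod fun l n => ρ l ^ n) := by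
  have h := stub_binGermMemOan 0 (4 : ℂ) (f6_isAlgebraic_ofNat 4) f6_four_norm (1 / 2)
  exact ⟨h.1, h.2.1, h.2.2.1⟩

/-- `b` has absolutely summable coefficients. [folklore] -/
theorem f6_b_summable : Summable fun a : ℕ →₀ ℕ => ‖coeff a bF6‖ :=
  summable_norm_coeff_of_mem_Oan _ f6_bG1.1

/-- An algebraic constant `C c` lies in `𝒪_{ℚ-alg}(𝔻̄^∞)`. [folklore] -/
theorem f6_C_mem_Oan {c : ℂ} (hc : IsAlgebraic ℚ c) : (C c : CSeries) ∈ Oan (algebraMap ℚ ℂ) := by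
  rw [show (C c : CSeries) = c • (1 : CSeries) by rw [smul_eq_C_mul, mul_one]]
  exact smul_mem_Oan _ (by obtain ⟨p, hp, h⟩ := hc; exact ⟨p, hp, h⟩) (one_mem_Oan _)

/-- `2b ∈ 𝒪_{ℚ-alg}(𝔻̄^∞)`. [folklore] -/
theorem f6_two_b_mem_Oan : (2 : ℂ) • bF6 ∈ Oan (algebraMap ℚ ℂ) :=
  smul_mem_Oan _ (by obtain ⟨p, hp, h⟩ := f6_isAlgebraic_ofNat 2; exact ⟨p, hp, h⟩) f6_bG1.1

/-- **`F₀ ∈ 𝒪_{ℚ-alg}(𝔻̄^∞)`** (`κ` is algebraic). [folklore] -/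
theorem f6_F0_mem_Oan : F0F6 ∈ Oan (algebraMap ℚ ℂ) :=
  sub_mem_Oan _ f6_two_b_mem_Oan (f6_C_mem_Oan f6_isAlgebraic_kappa)

/-- `F₀` involves `z₀` only. [folklore] -/
theorem f6_F0_usesVar (l : ℕ) (h : UsesVar F0F6 l) : l = 0 := by
  rcases usesVar_sub h with h | h
  · exact f6_bG1.2.1 l (usesVar_of_smul h)
  · exfalso
    obtain ⟨a, ha, hne⟩ := h
    apply hne
    rw [coeff_C, if_neg]
    intro h0
    apply ha
    rw [h0]
    rfl

/-- **`F₀` has polyradius `≥ 7/2`**: `Σ_a ‖F₀_a‖ (7/2)^{|a|} < ∞` (`7/2 < 4 = ‖α‖`). [folklore] -/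
theorem f6_F0_ws : Summable fun a : ℕ →₀ ℕ => ‖coeff a F0F6‖ * (7 / 2 : ℝ) ^ degree a := by
  have hb := f6_bG1.2.2 (fun _ => (7 / 2 : ℝ)) (fun _ => by norm_num) (by norm_num)
  have hC : Summable fun a : ℕ →₀ ℕ =>
      ‖coeff a (C (-κF6) : CSeries)‖ * a.prod fun _ n => (7 / 2 : ℝ) ^ n := by
    refine summable_of_ne_finset_zero (s := {0}) fun a ha => ?_
    rw [Finset.mem_singleton] at ha
    rw [coeff_C, if_neg ha, norm_zero, zero_mul]
  have h := s6_ws_add (fun _ => by norm_num) (s6_ws_smul (2 : ℂ) hb) hC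
  rw [map_neg, ← sub_eq_add_neg] at h
  refine h.congr fun a => ?_
  simp only [s4_prod_const_pow]

/-! ## The substitution `z₀ ↦ u(z₀)`: `F₀(u(z₀)) = 2(1 − e z₀) − κ` -/

/-- `u(z₀)` has zero constant coefficient. [folklore] -/
theorem f6_constantCoeff_G : constantCoeff (Polynomial.aeval (X 0 : CSeries) uF6) = 0 :=
  v0_constantCoeff_aeval 0 f6_u_eval_zero

/-- The family `z₀ ↦ u(z₀)` is substitutable. [folklore] -/
theorem f6_hasSubst : HasSubst uFam[0, uF6] := v0_hasSubst 0 f6_constantCoeff_G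

/-- **`b(u(z₀))² = (1 − e z₀)²`**: `b² = 1 − z₀/4` (exponent law) and `1 − u(t)/4 = (1 − e t)²`.
[folklore] -/
theorem f6_subst_b_sq :
    (MvPowerSeries.subst uFam[0, uF6] bF6) ^ 2 = (1 - C eF6 * X 0) ^ 2 := by
  have ha := f6_hasSubst
  have hhalf : (((1 / 2 : ℚ) : ℂ)) + (((1 / 2 : ℚ) : ℂ)) = (1 : ℂ) := by push_cast; ring
  rw [sq (MvPowerSeries.subst _ _), ← subst_mul ha, ← g2_binGerm_add, hhalf, g2_binGerm_one,
    subst_sub ha, subst_mul ha, subst_C, subst_X ha 0, if_pos rfl, ← substAlgHom_apply ha, map_one,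
    map_add, c3_aeval_monomial, c3_aeval_monomial]
  have h4 : (C (4⁻¹ : ℂ) : CSeries) * 4 = 1 := by
    rw [← map_ofNat C 4, ← map_mul, inv_mul_cancel₀ (by norm_num), map_one]
  simp only [map_mul, map_neg, map_pow, map_ofNat]
  linear_combination (C eF6 ^ 2 * X 0 ^ 2 - 2 * C eF6 * X 0) * h4

/-- `b(u(z₀))(0) = b(0) = 1`. [folklore] -/
theorem f6_constantCoeff_subst_b : constantCoeff (MvPowerSeries.subst uFam[0, uF6] bF6) = 1 := by
  rw [← coeff_zero_eq_constantCoeff_apply,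
    v0_coeff_subst f6_bG1.2.1 f6_constantCoeff_G 0 (M := 1) (by simp),
    Finset.sum_range_one, g2_coeff_single, Ring.choose_zero_right, pow_zero, pow_zero,
    coeff_zero_one, mul_one, mul_one]

/-- **`b(u(z₀)) = 1 − e z₀`**: `(S − P)(S + P) = 0` in the domain `ℂ[[z]]` with `(S + P)(0) = 2`.
[folklore] -/
theorem f6_subst_b : MvPowerSeries.subst uFam[0, uF6] bF6 = 1 - C eF6 * X 0 := by
  have hsq : (MvPowerSeries.subst uFam[0, uF6] bF6 - (1 - C eF6 * X 0)) *
      (MvPowerSeries.subst uFam[0, uF6] bF6 + (1 - C eF6 * X 0)) = 0 := by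
    linear_combination f6_subst_b_sq
  have hne : MvPowerSeries.subst uFam[0, uF6] bF6 + (1 - C eF6 * X 0) ≠ 0 := by
    intro h0
    have h1 : constantCoeff (MvPowerSeries.subst uFam[0, uF6] bF6 + (1 - C eF6 * X 0)) = 2 := by
      rw [map_add, f6_constantCoeff_subst_b, map_sub, map_mul, constantCoeff_C, constantCoeff_X,
        map_one]
      norm_num
    rw [h0, map_zero] at h1
    norm_num at h1
  exact sub_eq_zero.mp ((mul_eq_zero.mp hsq).resolve_right hne)

/-- **`F₀(u(z₀)) = 2(1 − e z₀) − κ`**, a polynomial in `z₀`. [folklore] -/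
theorem f6_subst_F0 : MvPowerSeries.subst uFam[0, uF6] F0F6 = Polynomial.aeval (X 0 : CSeries) pF6 := by
  have ha := f6_hasSubst
  rw [subst_sub ha, subst_smul ha, subst_C, f6_subst_b, map_add, c3_aeval_monomial,
    c3_aeval_monomial, smul_eq_C_mul]
  simp only [map_sub, map_mul, map_neg, map_ofNat, pow_zero, pow_one, mul_one]
  ring

/-- The coefficients of `2(1 − e t) − κ` are algebraic. [folklore] -/
theorem f6_p_alg (n : ℕ) : IsAlgebraic ℚ (Polynomial.coeff pF6 n) := by
  rw [Polynomial.coeff_add, Polynomial.coeff_monomial, Polynomial.coeff_monomial]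
  refine IsAlgebraic.add ?_ ?_
  · split_ifs
    · exact (f6_isAlgebraic_ofNat 2).sub f6_isAlgebraic_kappa
    · exact isAlgebraic_zero
  · split_ifs
    · exact ((f6_isAlgebraic_ofNat 2).mul f6_isAlgebraic_e).neg
    · exact isAlgebraic_zero

/-- **Rationality of the pulled-back integrand**: `F₀(u(z₀))·u′(z₀)` is the polynomial
`(2(1 − e z₀) − κ)·u′(z₀)` with algebraic coefficients. [folklore] -/
theorem f6_rat :
    ∃ A B : Polynomial ℂ, B ≠ 0 ∧ (∀ n, IsAlgebraic ℚ (A.coeff n)) ∧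
      (∀ n, IsAlgebraic ℚ (B.coeff n)) ∧
      Polynomial.aeval (X 0 : CSeries) B *
          (MvPowerSeries.subst uFam[0, uF6] F0F6 *
            Polynomial.aeval (X 0 : CSeries) (Polynomial.derivative uF6)) =
        Polynomial.aeval (X 0 : CSeries) A := by
  refine ⟨pF6 * Polynomial.derivative uF6, 1, one_ne_zero, fun n => ?_, fun n => ?_, ?_⟩
  · -- adapted from `f2_isAlgebraic_coeff_mul` (…StubMultiPieceRatLayer.lean)
    rw [Polynomial.coeff_mul]
    exact l1_isAlgebraic_sum _ _ fun x _ => (f6_p_alg x.1).mul (f6_du_alg x.2)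
  · rw [Polynomial.coeff_one]
    split_ifs
    · exact isAlgebraic_one
    · exact isAlgebraic_zero
  · rw [map_one, one_mul, f6_subst_F0, ← map_mul]

/-! ## The integral: `∫₀¹ (1 − z/4)^{1/2} dz = 8/3 − √3`, so `∫ F₀ = 0` -/

/-- `(3/4)^{3/2} = 3√3/8` (principal power of a positive real). [folklore] -/
theorem f6_cpow : (1 - (4 : ℂ)⁻¹) ^ ((((1 / 2 : ℚ) : ℂ)) + 1) = 3 * rt3 / 8 := by
  have hs : Real.sqrt (3 / 4) = Real.sqrt 3 / 2 := by
    rw [Real.sqrt_div' _ (by norm_num), show (4 : ℝ) = 2 ^ 2 by norm_num, Real.sqrt_sq (by norm_num)]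
  rw [Complex.cpow_add _ _ (by norm_num), Complex.cpow_one,
    show (1 - (4 : ℂ)⁻¹) = ((3 / 4 : ℝ) : ℂ) by push_cast; norm_num,
    show (((1 / 2 : ℚ) : ℂ)) = ((1 / 2 : ℝ) : ℂ) by push_cast; norm_num,
    ← Complex.ofReal_cpow (by norm_num), ← Real.sqrt_eq_rpow, hs]
  push_cast
  ring

/-- **`∫₀¹ (1 − z₀/4)^{1/2} dz₀ = 8/3 − √3`**: with the primitive `G = −(8/3)(1 − z₀/4)^{3/2}`
(`∂₀ G = b`), `b = (∂₀G − G|_{z₀=1} + G|_{z₀=0}) + (G|_{z₀=1} − G|_{z₀=0})`, type (a) integrates to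
zero, `G|_{z₀=1} = −(8/3)(3/4)^{3/2}`, `G|_{z₀=0} = −8/3`. [folklore] -/
theorem f6_intC_b : intC bF6 = 8 / 3 - rt3 := by
  have h4 := f6_four_norm
  have hpdz : pdz 0 ((-(8 / 3 : ℂ)) • binGerm[0, (4 : ℂ), (((1 / 2 : ℚ) : ℂ)) + 1]) = bF6 := by
    rw [pdz_smul, g2_pdz_binGerm, add_sub_cancel_right, smul_smul]
    have e : (-(8 / 3 : ℂ)) * -(((((1 / 2 : ℚ) : ℂ)) + 1) * (4 : ℂ)⁻¹) = 1 := by push_cast; norm_num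
    rw [e, one_smul]
  have hr1 : restrC 0 1 ((-(8 / 3 : ℂ)) • binGerm[0, (4 : ℂ), (((1 / 2 : ℚ) : ℂ)) + 1]) =
      C (-(8 / 3 : ℂ) * (3 * rt3 / 8)) := by
    rw [restrC_smul, g3_restrC_one_binGerm 0 h4, f6_cpow, smul_eq_C_mul, ← map_mul]
  have hr0 : restrC 0 0 ((-(8 / 3 : ℂ)) • binGerm[0, (4 : ℂ), (((1 / 2 : ℚ) : ℂ)) + 1]) =
      C (-(8 / 3 : ℂ)) := by
    rw [restrC_smul, g2_restrC_zero_binGerm, smul_eq_C_mul, mul_one]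
  have hrel : relAC 0 ((-(8 / 3 : ℂ)) • binGerm[0, (4 : ℂ), (((1 / 2 : ℚ) : ℂ)) + 1]) =
      bF6 - C (-(8 / 3 : ℂ) * (3 * rt3 / 8)) + C (-(8 / 3 : ℂ)) := by
    rw [relAC, hpdz, hr1, hr0]
  have hGsum : Summable fun a : ℕ →₀ ℕ =>
      ‖coeff a ((-(8 / 3 : ℂ)) • binGerm[0, (4 : ℂ), (((1 / 2 : ℚ) : ℂ)) + 1])‖ := by
    have h := summable_norm_coeff_of_hasPolyradiusGtOne (g1_hasPolyradiusGtOne_binGerm 0 h4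
      ((((1 / 2 : ℚ) : ℂ)) + 1))
    refine (h.mul_left ‖(-(8 / 3 : ℂ))‖).congr fun a => ?_
    rw [coeff_smul, norm_mul]
  have hRsum : Summable fun a : ℕ →₀ ℕ =>
      ‖coeff a (relAC 0 ((-(8 / 3 : ℂ)) • binGerm[0, (4 : ℂ), (((1 / 2 : ℚ) : ℂ)) + 1]))‖ := by
    rw [hrel, sub_eq_add_neg, ← map_neg]
    exact s4_summable_norm_coeff_add (s4_summable_norm_coeff_add f6_b_summable (c3_summable_C _))
      (c3_summable_C _)
  have hb : bF6 = relAC 0 ((-(8 / 3 : ℂ)) • binGerm[0, (4 : ℂ), (((1 / 2 : ℚ) : ℂ)) + 1]) +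
      C (-(8 / 3 : ℂ) * (3 * rt3 / 8) - (-(8 / 3 : ℂ))) := by
    rw [hrel, map_sub]
    ring
  rw [hb, l1_intC_add hRsum (c3_summable_C _), intC_relAC_eq_zero hGsum 0, l1_intC_C]
  ring

/-- **`∫ F₀ = 2(8/3 − √3) − (16/3 − 2√3) = 0`.** [folklore] -/
theorem f6_intC_F0 : intC F0F6 = 0 := by
  rw [intC_sub (summable_norm_coeff_of_mem_Oan _ f6_two_b_mem_Oan) (c3_summable_C _), intC_smul,
    f6_intC_b, l1_intC_C]
  ring

/-! ## The stub -/

/-- **F6 — THE FIRST IRRATIONAL ALGEBRAIC INSTANCE of Conj. 1.1 certified inside type (a)**, GIVEN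
Layer 1.5: `F₀ = √(4 − z₀) − (2/3)(8 − 3√3) = 2·(1 − z₀/4)^{1/2} − (16/3 − 2√3)` (`∫₀¹ √(4−z) dz =
(2/3)(8 − 3√3)`, algebraic!) is type (a): with `e = 1 − √3/2` (`c = 2e = 2 − √3`) and
`u(t) = 8e t − 4e² t² = 4ct − c²t²` one has `u(0) = 0`, `u(1) = 1`, `4 − u(t) = (2 − ct)²`, so
`F₀(u(t)) = 2 − ct − (16/3 − 2√3)` is a POLYNOMIAL and `F₀(u)u′` is rational; the room
`2 + 4c + c² ≈ 3.14 < 7/2 < 4 =` polyradius of `F₀` holds without normalisation.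
[cite: Ayoub2015, Conj. 1.1] -/
theorem stub_sqrtInstance_of :
    (∀ (i : ℕ) (u : Polynomial ℂ), (∀ n, IsAlgebraic ℚ (u.coeff n)) → u.eval 0 = 0 → u.eval 1 = 1 → ∀ (F : CSeries), F ∈ Oan (algebraMap ℚ ℂ) → (∀ l : ℕ, UsesVar F l → l = i) → ∀ (r : ℝ), 2 + (∑ n ∈ u.support, ‖u.coeff n‖) < r → Summable (fun a : ℕ →₀ ℕ => ‖MvPowerSeries.coeff a F‖ * r ^ degree a) → (∃ A B : Polynomial ℂ, B ≠ 0 ∧ (∀ n, IsAlgebraic ℚ (A.coeff n)) ∧ (∀ n, IsAlgebraic ℚ (B.coeff n)) ∧ Polynomial.aeval (X i : CSeries) B * (MvPowerSeries.subst uFam[i, u] F * Polynomial.aeval (X i : CSeries) (Polynomial.derivative u)) = Polynomial.aeval (X i : CSeries) A) → intC F = 0 → F ∈ (kSpan (algebraMap ℚ ℂ) {x : CSeries | ∃ G ∈ Oan (algebraMap ℚ ℂ), ∃ n : ℕ, x = relAC n G})) →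
    (2 : ℂ) • binGerm[0, (4 : ℂ), ((1 / 2 : ℚ) : ℂ)] - C ((16 / 3 : ℂ) - 2 * ((Real.sqrt 3 : ℝ) : ℂ)) ∈
      kSpan (algebraMap ℚ ℂ) {x : CSeries | ∃ G ∈ Oan (algebraMap ℚ ℂ), ∃ n : ℕ, x = relAC n G} := by
  intro hL
  exact hL 0 uF6 f6_u_alg f6_u_eval_zero f6_u_eval_one F0F6 f6_F0_mem_Oan f6_F0_usesVar (7 / 2)
    f6_room f6_F0_ws f6_rat f6_intC_F0

end Summit.KontsevichZagierPeriods.KontsevichZagierPeriods.TypeAGenerationLine
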